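import Summits.QuantumFields.BalabanUV.T4Continuum.Support.NE7MultiplierDensity
import HarnessLib

/-!
# NE7FrameFreeDifferential — ON TOP-FRAME-FREE DIRECTIONS THE DIFFERENTIAL OF THE FRAMED `(j+1)`-FOLD AVERAGE IS THE STRAIGHT TOWER: `framePotW L (j+1) W φ = 0 ⟹ levelQ′ L M′ j W (res φ) =
# skewPR M′ (res (QbarIter L (j+1) W φ))` (lineage `b2b-balaban-t4-ne7-p1`, gen 119, file H4 = the «frame-free bridge» of ROAD-G119 §2(d)∕§5 S3)

Cell `pub-balaban`, rung (B)+1 sub-cell t4, CRUX PROVER NE7 #1 (OWNER of row NE7), generation 119.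
WHY (memo ROAD-G119 §2(d)).  H3 ✓ `NE7StrippedConstraintSocket.multiplier_transport_levelQ` (ii) computes the multiplier term of the bordered Hessian through the STRIPPED (double-bar) constraint `Ψ`
on exactly those fine directions `X` with `Q′X = DΨ(0)X`, and `DΨ(0)` is the straight tower `QbarIter` (read on the torus).  By row NE3's structure theorem ✓ `dirIter_eq_QbarIter_add_gaugeDir`
(`dirIter = QbarIter + gaugeDir(cavgIter)(framePotW)`) and row NE7b's dictionary ✓ `NE7MultiplierDensity.levelQ'_resDir_eq_skewPR_dirIter` (`levelQ′(res φ) = skewPR(res(dirIter φ))`), the framed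
differential `Q′ = levelQ′` agrees with `skewPR∘res∘QbarIter` on every direction whose ACCUMULATED FRAME GENERATOR VANISHES — the slice representatives `R₀ṽ + T_♮(U♯)` of ✓ `NE7SliceRepLetters`
(`T_♮ = frameFreeBlockLandauW`, `R₀ = rightInvW0` top-frame-free).  THIS FILE is that bridge (general `d`, base `W` in the multi-level class).
WHAT ([folklore]; 0 def, 0 sorry): `gaugeDir_fun_zero` (`gaugeDir W 0 = 0`); **`levelQ'_resDir_eq_skewPR_QbarIter_of_frameFree`**; **`levelQ'_eq_skewPR_QbarIter_of_frameFree`** (torus form: for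
`X : TDir` with `framePotW L (j+1) W X̃ = 0`, `X̃ = chartDir id X`: `levelQ′ W X = skewPR(res(QbarIter L (j+1) W X̃))`).
HONEST FRAMING (page 1): composition of landed kernel theorems; nothing of Bałaban's asserted ([Balaban1985Averaging] (42), (112), (120) context only); NOT (G′), NOT NE7 as a spine node; spine
0∕9; finite T⁴ rung (B)+1 — NOT infinite volume, NOT mass gap, NOT BetaPertH, NOT Clay.
-/

set_option autoImplicit false

open scoped BigOperators Matrix Matrix.Norms.L2Operator Topology

namespace Summit.QuantumFields.BalabanUV.T4Continuum.NE7FrameFreeDifferential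

open Literature.MathematicalPhysics.QuantumFieldTheory.Balaban1983to89
open B7Prop1Explicit B7Prop2Explicit
open T4AveragingDeficitWall (IsUnitaryCfg IsSkewDir SmallField)
open T4AveragingDeficitWallBoundary (IsPeriodicCfg)
open AveragingDeficitPeriodicCounting (IsPeriodicDir)
open AveragingDeficitTorusChart (TDir chartDir resDir extDir resDir_extDir isPeriodicDir_chartDir)
open AveragingDeficitTwoLevelPrep (skewSub skewPR)
open AveragingDeficitMultiLevelPrep (tower cavgIter levelQ' LevelSmall natCast_tower_succ)
open BlockAveragePushDirGauge (gaugeDir)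
open NE3TangentCovariantTower (dirIter QbarIter framePotW dirIter_eq_QbarIter_add_gaugeDir)
open NE7MultiplierDensity (levelQ'_resDir_eq_skewPR_dirIter chartDir_id_eq_extDir)
open NE7FlatAverageCurlCommutation (isSkewDir_chartDir_id)

noncomputable section

variable {d : ℕ} {n : Type} [Fintype n] [DecidableEq n]

/-- The gauge direction generated by the zero site field vanishes. [folklore] -/
theorem gaugeDir_fun_zero (W : Site d → Fin d → (Matrix n n ℂ)ˣ) (z : Site d) (κ : Fin d) :
    gaugeDir W (fun _ : Site d => (0 : Matrix n n ℂ)) z κ = 0 := by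
  simp [gaugeDir, T4AveragingDeficitWall.Ad]

/-- **ON TOP-FRAME-FREE DIRECTIONS THE FRAMED DIFFERENTIAL IS THE STRAIGHT TOWER** (direction-field form): for `L ≥ 1`, a unitary `(L·tower L M′ j)`-periodic base `W` with `0 ≤ x`,
`LevelSmall d L j x`, `SmallField W x`, and a skew `(L·tower L M′ j)`-periodic `φ` whose accumulated frame generator vanishes (`framePotW L (j+1) W φ = 0`):
`levelQ′ L M′ j W (res φ) = skewPR M′ (res (QbarIter L (j+1) W φ))`. [folklore] -/
theorem levelQ'_resDir_eq_skewPR_QbarIter_of_frameFree [Nonempty n] {L M' : ℕ} [NeZero L] [NeZero M'] (hL : 1 ≤ L) (j : ℕ)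
    {W : Site d → Fin d → (Matrix n n ℂ)ˣ} {x : ℝ} (hW : IsUnitaryCfg W) (hWP : IsPeriodicCfg W ((L : ℤ) * (tower L M' j : ℕ)))
    (hx : 0 ≤ x) (hs : LevelSmall d L j x) (hWx : SmallField W x) {φ : Site d → Fin d → Matrix n n ℂ} (hφs : IsSkewDir φ)
    (hφP : IsPeriodicDir φ ((L * tower L M' j : ℕ) : ℤ)) (hff : framePotW L (j + 1) W φ = fun _ => 0) :
    levelQ' L M' j W (resDir (L * tower L M' j) φ) = skewPR (d := d) (n := n) M' (resDir M' (QbarIter L (j + 1) W φ)) := by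
  rw [levelQ'_resDir_eq_skewPR_dirIter hL j hW hWP hx hs hWx hφP]
  have hWP' : IsPeriodicCfg W ((tower L M' (j + 1) : ℕ) : ℤ) := by rw [natCast_tower_succ]; exact hWP
  have hφP' : IsPeriodicDir φ ((tower L M' (j + 1) : ℕ) : ℤ) := by
    rw [natCast_tower_succ]
    have e : ((L * tower L M' j : ℕ) : ℤ) = (L : ℤ) * (tower L M' j : ℕ) := by push_cast; ring
    rw [← e]; exact hφP
  have hstr := dirIter_eq_QbarIter_add_gaugeDir (M := M') hL j hW hWP' hx hs hWx hφs hφP'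
  have hdir : dirIter L (j + 1) W φ = QbarIter L (j + 1) W φ := by
    rw [hstr]
    funext z κ
    rw [hff, gaugeDir_fun_zero, add_zero]
  rw [hdir]

/-- **THE SAME FOR TORUS DIRECTIONS**: for `X : TDir d n (L·tower L M′ j)` skew with `framePotW L (j+1) W X̃ = 0` (`X̃ = chartDir id X` its periodic extension):
`levelQ′ L M′ j W X = skewPR M′ (res (QbarIter L (j+1) W X̃))` — the hypothesis `Q′X = DΨ(0)X` of ✓ `NE7StrippedConstraintSocket.multiplier_transport_levelQ` (ii) once `DΨ(0) = skewPR∘res∘QbarIter`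
(ROAD-G119 §5 S3). [folklore] -/
theorem levelQ'_eq_skewPR_QbarIter_of_frameFree [Nonempty n] {L M' : ℕ} [NeZero L] [NeZero M'] (hL : 1 ≤ L) (j : ℕ)
    {W : Site d → Fin d → (Matrix n n ℂ)ˣ} {x : ℝ} (hW : IsUnitaryCfg W) (hWP : IsPeriodicCfg W ((L : ℤ) * (tower L M' j : ℕ)))
    (hx : 0 ≤ x) (hs : LevelSmall d L j x) (hWx : SmallField W x) {X : TDir d n (L * tower L M' j)} (hX : X ∈ skewSub d n (L * tower L M' j))
    (hff : framePotW L (j + 1) W (chartDir (ContinuousLinearMap.id ℝ (Matrix n n ℂ)) (L * tower L M' j) X) = fun _ => 0) :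
    levelQ' L M' j W X
      = skewPR (d := d) (n := n) M' (resDir M' (QbarIter L (j + 1) W (chartDir (ContinuousLinearMap.id ℝ (Matrix n n ℂ)) (L * tower L M' j) X))) := by
  haveI : NeZero (L * tower L M' j) := ⟨Nat.mul_ne_zero (NeZero.ne L) (AveragingDeficitMultiLevelPrep.tower_ne_zero L M' j)⟩
  have hXres : X = resDir (L * tower L M' j) (chartDir (ContinuousLinearMap.id ℝ (Matrix n n ℂ)) (L * tower L M' j) X) := by
    rw [chartDir_id_eq_extDir, resDir_extDir]
  conv_lhs => rw [hXres]
  exact levelQ'_resDir_eq_skewPR_QbarIter_of_frameFree hL j hW hWP hx hs hWx (isSkewDir_chartDir_id hX)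
    (isPeriodicDir_chartDir (ContinuousLinearMap.id ℝ (Matrix n n ℂ)) (L * tower L M' j) X) hff

end

end Summit.QuantumFields.BalabanUV.T4Continuum.NE7FrameFreeDifferential
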